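import Summits.CriticalPhenomena.SAWScalingLimit.Theorems.SAWDevelopingMapHexConjectureFloorSharedEstimates
import Summits.CriticalPhenomena.SAWScalingLimit.Theorems.SAWDevelopingMapHexConjectureRestrictionCocycleOfRatioModulus
import Summits.CriticalPhenomena.SAWScalingLimit.Theorems.SAWDevelopingMapObservableToSLETargetTransport
import Summits.CriticalPhenomena.SAWScalingLimit.Theorems.SAWDevelopingMapHexConjectureAvoidanceCocycleFloor
import HarnessLib

/-!
# Crux `HexConjecture` (stmt-CriticalPhenomena-0808), line `root-locality-replaces-loewner`:
the floor class from the MODULUS FLOOR-RATIO LIMIT (statement 1 weakened: boundary partition-function ratios only)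

Landing target:
`Summits/CriticalPhenomena/SAWScalingLimit/Theorems/SAWDevelopingMapHexConjectureFloorRatioAssembly.lean`
(`--supports stmt-CriticalPhenomena-0808`; lead continuation prover-line-stmt-CriticalPhenomena-0808-c1-0).

The restriction line consumes DCS Conjecture 2 (`HexObservableLimit(R)`, stmt-CriticalPhenomena-14003: the bulk
parafermionic observable, `ψ`-averaged, normalised at a boundary mid-edge) ONLY through crux-10472's target transport,
and of that only the MODULI (`restrictionCocycle_of_floorRatioModulus`), i.e. through the **modulus floor-ratio limit**
`FloorRatioModulusLimit`: for two floor mid-edges `b, b'` of a floor domain, `‖F_δ(b'_δ)/F_δ(b_δ)‖ = Z_δ(a → b')/Z_δ(a → b) →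
exp((5/8) Re(L_{b'} - L_b)) = |Φ'(b')/Φ'(b)|^{5/8}` — a statement about ratios of POSITIVE critical boundary partition functions
(`‖F_δ(p)‖ = Z_δ(a→p)` at floor exits): boundary conformal covariance with the boundary exponent 5/8.  It is implied by
Conj. 2 (`floorRatioModulus_of_hexObservableLimit`: target transport p72986 + `Tendsto.norm`) and is a priori much weaker (no bulk value
and no phase of the observable).  With the observable-free restriction cocycle
`restrictionCocycle_of_floorRatioModulus` (sibling file `…RestrictionCocycleOfRatioModulus`, p116941), the whole floor-class chain runs
from it:

* `hexAvoidanceCocycleFloor_of_floorRatioLimit : FloorRatioModulusLimit → HalfPlaneArchTightness → HexAvoidanceCocycleFloor`;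
* `hexConjectureFloor_of_floorRatioLimit : FloorRatioModulusLimit → HalfPlaneArchTightness → HexNonRetracingFloor → HexConjectureFloor`;
* `hexConjectureFloor_of_boundaryEstimates : FloorRatioModulusLimit → HalfPlaneArchTightness → UniformModulus → HexConjectureFloor` —
  **the floor class of DCS Conjecture 1 from three estimates on boundary ratios / boundary arches / injectivity moduli,
  with no bulk observable and no tightness input.**
-/

noncomputable section

open scoped Topology NNReal ENNReal
open Filter Set Metric MeasureTheory
open Literature.Probability.LatticeModels (HexVertex hexGraph hexCenter)
open Literature.Probability.RandomPlanarGeometry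
open Literature.Probability.RandomPlanarGeometry.SAW
open UpperHalfPlane (upperHalfPlaneSet)
open Summit.CriticalPhenomena.SAWScalingLimit.Theorems.ObservableToSLE.FloorRatio
  (canonicalTransfer_of_hullApprox stub_shortChordLocality_reduction)

namespace Summit.CriticalPhenomena.SAWScalingLimit.Theorems.HexConjecture.RootLocality

/-- **DCS Conjecture 2 implies the modulus floor-ratio limit**: crux-10472's target transport (`FloorRatio.stub_targetTransport`, p72986)
followed by `Tendsto.norm` (`tendsto_norm_of_tendsto_exp_five_eighths`).  So the weakened statement 1 of the line is implied by item
stmt-CriticalPhenomena-14003. [cite: DuminilCopinSmirnov2012, Conjecture 2 (arXiv:1007.0575 p. 7), as hypothesis] -/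
theorem floorRatioModulus_of_hexObservableLimit
    (hO : Summit.CriticalPhenomena.SAWScalingLimit.Theses.SAWDevelopingMap.HexObservableLimit) :
    ∀ (D D' : DobrushinDomain) (ρ : ℝ) (Λ : ℝ → Finset HexVertex) (m₀ m m' : ℝ → ℤ) (a b b' : ℝ → Sym2 HexVertex) (Φ : ConformalEquiv D.carrier upperHalfPlaneSet) (L : ℂ → ℂ) (Lb Lb' : ℂ), D'.carrier = D.carrier → D'.pt 0 = D.pt 0 → 0 < ρ → D.carrier ∩ ball (D.pt 0) ρ = {z : ℂ | (D.pt 0).im < z.im} ∩ ball (D.pt 0) ρ → D.carrier ∩ ball (D.pt 1) ρ = {z : ℂ | (D.pt 1).im < z.im} ∩ ball (D.pt 1) ρ → D.carrier ∩ ball (D'.pt 1) ρ = {z : ℂ | (D'.pt 1).im < z.im} ∩ ball (D'.pt 1) ρ → (∀ᶠ δ : ℝ in 𝓝[>] 0, hexDomainSimplyConnected (Λ δ) ∧ a δ ∈ hexDomainBoundary (Λ δ) ∧ b δ ∈ hexDomainBoundary (Λ δ) ∧ b' δ ∈ hexDomainBoundary (Λ δ) ∧ Nonempty (HexMidEdgeSAW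 (Λ δ) (a δ) (b δ)) ∧ Nonempty (HexMidEdgeSAW (Λ δ) (a δ) (b' δ)) ∧ (hexGraph.induce (↑(Λ δ) : Set HexVertex)).Preconnected ∧ (∀ v ∈ Λ δ, (δ : ℂ) * hexCenter v ∈ D.carrier) ∧ (∀ v : HexVertex, (δ : ℂ) * hexCenter v ∈ ball (D.pt 0) ρ → (v ∈ Λ δ ↔ m₀ δ ≤ v.1 1)) ∧ (∀ v : HexVertex, (δ : ℂ) * hexCenter v ∈ ball (D.pt 1) ρ → (v ∈ Λ δ ↔ m δ ≤ v.1 1)) ∧ (∀ v : HexVertex, (δ : ℂ) * hexCenter v ∈ ball (D'.pt 1) ρ → (v ∈ Λ δ ↔ m' δ ≤ v.1 1))) → (∀ K : Set ℂ, IsCompact K → K ⊆ D.carrier → ∀ᶠ δ : ℝ in 𝓝[>] 0, ∀ v : HexVertex, (δ : ℂ) * hexCenter v ∈ K → v ∈ Λ δ) → Tendsto (fun δ : ℝ => (δ : ℂ) * hexMidpoint (a δ)) (𝓝[>] 0) (𝓝 (D.pt 0)) → Tendsto (fun δ : ℝ => (δ : ℂ) * hexMidpoint (b δ)) (𝓝[>]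 0) (𝓝 (D.pt 1)) → Tendsto (fun δ : ℝ => (δ : ℂ) * hexMidpoint (b' δ)) (𝓝[>] 0) (𝓝 (D'.pt 1)) → Tendsto (fun x => ‖Φ x‖) (𝓝[D.carrier] (D.pt 0)) atTop → Φ.HasBoundaryValue (D.pt 1) 0 → ContinuousOn L D.carrier → (∀ z ∈ D.carrier, Complex.exp (L z) = deriv Φ z) → Tendsto L (𝓝[D.carrier] (D.pt 1)) (𝓝 Lb) → Tendsto L (𝓝[D.carrier] (D'.pt 1)) (𝓝 Lb') → Tendsto (fun δ : ℝ => ‖hexParafermionicObservable (Λ δ) (a δ) hexCriticalFugacity (5 / 8) (b' δ) / hexParafermionicObservable (Λ δ) (a δ) hexCriticalFugacity (5 / 8) (b δ)‖) (𝓝[>] 0) (𝓝 (Real.exp ((5 / 8) * (Lb' - Lb).re))) :=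
  fun D D' ρ Λ m₀ m m' a b b' Φ L Lb Lb' h1 h2 h3 h4 h5 h6 h7 h8 h9 h10 h11 h12 h13 h14 h15 h16 h17 =>
    tendsto_norm_of_tendsto_exp_five_eighths
      (Summit.CriticalPhenomena.SAWScalingLimit.Theorems.ObservableToSLE.FloorRatio.stub_targetTransport hO D D' ρ Λ m₀ m m'
        a b b' Φ L Lb Lb' h1 h2 h3 h4 h5 h6 h7 h8 h9 h10 h11 h12 h13 h14 h15 h16 h17)

/-- **The floor-class avoidance cocycle from the floor-ratio limit and arch tightness.**
`FloorRatioLimit → HalfPlaneArchTightness → HexAvoidanceCocycleFloor`: short-chord locality from arch tightness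
(`FloorRatio.stub_shortChordLocality_reduction`), the observable-free restriction cocycle
(`restrictionCocycle_of_floorRatioModulus`, p116941), the canonical transfer under the hull approximation
(`FloorRatio.canonicalTransfer_of_hullApprox`, `stub_avoidanceCocycleFloor_hullApprox`) and the sandwich
(`hexAvoidanceCocycleFloor_of_floorRestrictionLimit`).
[cite: LawlerSchrammWerner2004SAW, §3.4 ("SAW satisfies restriction") and Prop. 2] -/
theorem hexAvoidanceCocycleFloor_of_floorRatioLimit
    (hF : ∀ (D D' : DobrushinDomain) (ρ : ℝ) (Λ : ℝ → Finset HexVertex) (m₀ m m' : ℝ → ℤ) (a b b' : ℝ → Sym2 HexVertex) (Φ : ConformalEquiv D.carrier upperHalfPlaneSet) (L : ℂ → ℂ) (Lb Lb' : ℂ), D'.carrier = D.carrier → D'.pt 0 = D.pt 0 → 0 < ρ → D.carrier ∩ ball (D.pt 0) ρ = {z : ℂ | (D.pt 0).im < z.im} ∩ ball (D.pt 0) ρ → D.carrier ∩ ball (D.pt 1) ρ = {z : ℂ | (D.pt 1).im < z.im} ∩ ball (D.pt 1) ρ → D.carrier ∩ ball (D'.pt 1) ρ = {z : ℂ | (D'.pt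 1).im < z.im} ∩ ball (D'.pt 1) ρ → (∀ᶠ δ : ℝ in 𝓝[>] 0, hexDomainSimplyConnected (Λ δ) ∧ a δ ∈ hexDomainBoundary (Λ δ) ∧ b δ ∈ hexDomainBoundary (Λ δ) ∧ b' δ ∈ hexDomainBoundary (Λ δ) ∧ Nonempty (HexMidEdgeSAW (Λ δ) (a δ) (b δ)) ∧ Nonempty (HexMidEdgeSAW (Λ δ) (a δ) (b' δ)) ∧ (hexGraph.induce (↑(Λ δ) : Set HexVertex)).Preconnected ∧ (∀ v ∈ Λ δ, (δ : ℂ) * hexCenter v ∈ D.carrier) ∧ (∀ v : HexVertex, (δ : ℂ) * hexCenter v ∈ ball (D.pt 0) ρ → (v ∈ Λ δ ↔ m₀ δ ≤ v.1 1)) ∧ (∀ v : HexVertex, (δ : ℂ) * hexCenter v ∈ ball (D.pt 1) ρ → (v ∈ Λ δ ↔ m δ ≤ v.1 1)) ∧ (∀ v : HexVertex, (δ : ℂ) * hexCenter v ∈ ball (D'.pt 1) ρ → (v ∈ Λ δ ↔ m' δ ≤ v.1 1))) → (∀ K : Set ℂ, IsCompact K → K ⊆ D.carrier → ∀ᶠ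 δ : ℝ in 𝓝[>] 0, ∀ v : HexVertex, (δ : ℂ) * hexCenter v ∈ K → v ∈ Λ δ) → Tendsto (fun δ : ℝ => (δ : ℂ) * hexMidpoint (a δ)) (𝓝[>] 0) (𝓝 (D.pt 0)) → Tendsto (fun δ : ℝ => (δ : ℂ) * hexMidpoint (b δ)) (𝓝[>] 0) (𝓝 (D.pt 1)) → Tendsto (fun δ : ℝ => (δ : ℂ) * hexMidpoint (b' δ)) (𝓝[>] 0) (𝓝 (D'.pt 1)) → Tendsto (fun x => ‖Φ x‖) (𝓝[D.carrier] (D.pt 0)) atTop → Φ.HasBoundaryValue (D.pt 1) 0 → ContinuousOn L D.carrier → (∀ z ∈ D.carrier, Complex.exp (L z) = deriv Φ z) → Tendsto L (𝓝[D.carrier] (D.pt 1)) (𝓝 Lb) → Tendsto L (𝓝[D.carrier] (D'.pt 1)) (𝓝 Lb') → Tendsto (fun δ : ℝ => ‖hexParafermionicObservable (Λ δ) (a δ) hexCriticalFugacity (5 / 8) (b' δ) / hexParafermionicObservable (Λ δ) (a δ) hexCriticalFugacity (5 / 8) (b δ)‖) (𝓝[>] 0) (𝓝 (Real.exp ((5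 / 8) * (Lb' - Lb).re))))
    (hT : ∀ ε : ℝ, 0 < ε → ∃ K : ℝ, 0 < K ∧ ∀ (n : ℕ), 1 ≤ n → ∀ (Λ B : Finset HexVertex)
      (s t : Sym2 HexVertex), s ∈ hexDomainBoundary Λ → t ∈ hexDomainBoundary Λ → s ≠ t →
      dist (hexMidpoint s) (hexMidpoint t) ≤ n → (hexMidpoint t).im = (hexMidpoint s).im →
      (∀ v ∈ Λ, (hexMidpoint s).im < (hexCenter v).im) →
      (∀ v : HexVertex, v ∈ B ↔ ((hexMidpoint s).im < (hexCenter v).im ∧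
        dist (hexCenter v) (hexMidpoint s) ≤ 2 * K * n)) →
      (∑ γ : HexMidEdgeSAW Λ s t, if ∃ v ∈ γ.verts, K * n ≤ dist (hexCenter v) (hexMidpoint s)
        then hexCriticalFugacity ^ γ.length else 0) ≤
      ε * ∑ γ : HexMidEdgeSAW B s t, hexCriticalFugacity ^ γ.length) :
    ∀ (D D' : DobrushinDomain) (ρ : ℝ) (a b : ℝ → HexVertex) (μ : Measure (CurveClass ℂ)),
      (0 < ρ ∧ (D.pt 1).im = (D.pt 0).im ∧ D.carrier ⊆ {z : ℂ | (D.pt 0).im < z.im} ∧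
        D.carrier ∩ ball (D.pt 0) ρ = {z : ℂ | (D.pt 0).im < z.im} ∩ ball (D.pt 0) ρ ∧
        D.carrier ∩ ball (D.pt 1) ρ = {z : ℂ | (D.pt 1).im < z.im} ∩ ball (D.pt 1) ρ) →
      IsEmbEndpointApprox hexGraph hexCenter D a b →
      (∀ᶠ δ : ℝ in 𝓝[>] 0,
        (a δ ∈ embMeshDomain hexGraph hexCenter D.carrier δ ∧
          ∃ w, hexGraph.Adj (a δ) w ∧ ¬ (hexDomainGraph D.carrier δ).Adj (a δ) w) ∧
        (b δ ∈ embMeshDomain hexGraph hexCenter D.carrier δ ∧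
          ∃ w, hexGraph.Adj (b δ) w ∧ ¬ (hexDomainGraph D.carrier δ).Adj (b δ) w)) →
      D.IsHullSubdomain D' → IsSLELaw ((8 : ℝ≥0) / 3) D μ →
      Tendsto (fun δ : ℝ =>
        ((hexSAWLaw D.carrier δ (a δ) (b δ)).map
            (fun γ : HexDomainSAW D.carrier δ (a δ) (b δ) => γ.curve))
          (CurveClass.rangeSubset (closure D'.carrier)))
        (𝓝[>] 0) (𝓝 (μ (CurveClass.rangeSubset (closure D'.carrier)))) :=
  hexAvoidanceCocycleFloor_of_floorRestrictionLimit
    (canonicalTransfer_of_hullApprox stub_avoidanceCocycleFloor_hullApprox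
      (restrictionCocycle_of_floorRatioModulus hF (stub_shortChordLocality_reduction hT)))

/-- **The crux on the floor class from the floor-ratio limit, arch tightness and non-retracing** (this line's primary
composition after the lead's third reshape: statement 1 = `FloorRatioLimit`, lever = `HalfPlaneArchTightness`, regularity =
`HexNonRetracingFloor`; statements 3–4–6 landed).
[cite: LawlerSchrammWerner2004SAW, §3.4 ("SAW satisfies restriction") and Prop. 2] -/
theorem hexConjectureFloor_of_floorRatioLimit
    (hF : ∀ (D D' : DobrushinDomain) (ρ : ℝ) (Λ : ℝ → Finset HexVertex) (m₀ m m' : ℝ → ℤ) (a b b' : ℝ → Sym2 HexVertex) (Φ : ConformalEquiv D.carrier upperHalfPlaneSet) (L : ℂ → ℂ) (Lb Lb' : ℂ), D'.carrier = D.carrier → D'.pt 0 = D.pt 0 → 0 < ρ → D.carrier ∩ ball (D.pt 0) ρ = {z : ℂ | (D.pt 0).im < z.im} ∩ ball (D.pt 0) ρ → D.carrier ∩ ball (D.pt 1) ρ = {z : ℂ | (D.pt 1).im < z.im} ∩ ball (D.pt 1) ρ → D.carrier ∩ ball (D'.pt 1) ρ = {z : ℂ | (D'.pt 1).im < z.im}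 ∩ ball (D'.pt 1) ρ → (∀ᶠ δ : ℝ in 𝓝[>] 0, hexDomainSimplyConnected (Λ δ) ∧ a δ ∈ hexDomainBoundary (Λ δ) ∧ b δ ∈ hexDomainBoundary (Λ δ) ∧ b' δ ∈ hexDomainBoundary (Λ δ) ∧ Nonempty (HexMidEdgeSAW (Λ δ) (a δ) (b δ)) ∧ Nonempty (HexMidEdgeSAW (Λ δ) (a δ) (b' δ)) ∧ (hexGraph.induce (↑(Λ δ) : Set HexVertex)).Preconnected ∧ (∀ v ∈ Λ δ, (δ : ℂ) * hexCenter v ∈ D.carrier) ∧ (∀ v : HexVertex, (δ : ℂ) * hexCenter v ∈ ball (D.pt 0) ρ → (v ∈ Λ δ ↔ m₀ δ ≤ v.1 1)) ∧ (∀ v : HexVertex, (δ : ℂ) * hexCenter v ∈ ball (D.pt 1) ρ → (v ∈ Λ δ ↔ m δ ≤ v.1 1)) ∧ (∀ v : HexVertex, (δ : ℂ) * hexCenter v ∈ ball (D'.pt 1) ρ → (v ∈ Λ δ ↔ m' δ ≤ v.1 1))) → (∀ K : Set ℂ, IsCompact K → K ⊆ D.carrier → ∀ᶠ δ : ℝ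 in 𝓝[>] 0, ∀ v : HexVertex, (δ : ℂ) * hexCenter v ∈ K → v ∈ Λ δ) → Tendsto (fun δ : ℝ => (δ : ℂ) * hexMidpoint (a δ)) (𝓝[>] 0) (𝓝 (D.pt 0)) → Tendsto (fun δ : ℝ => (δ : ℂ) * hexMidpoint (b δ)) (𝓝[>] 0) (𝓝 (D.pt 1)) → Tendsto (fun δ : ℝ => (δ : ℂ) * hexMidpoint (b' δ)) (𝓝[>] 0) (𝓝 (D'.pt 1)) → Tendsto (fun x => ‖Φ x‖) (𝓝[D.carrier] (D.pt 0)) atTop → Φ.HasBoundaryValue (D.pt 1) 0 → ContinuousOn L D.carrier → (∀ z ∈ D.carrier, Complex.exp (L z) = deriv Φ z) → Tendsto L (𝓝[D.carrier] (D.pt 1)) (𝓝 Lb) → Tendsto L (𝓝[D.carrier] (D'.pt 1)) (𝓝 Lb') → Tendsto (fun δ : ℝ => ‖hexParafermionicObservable (Λ δ) (a δ) hexCriticalFugacity (5 / 8) (b' δ) / hexParafermionicObservable (Λ δ) (a δ) hexCriticalFugacity (5 / 8) (b δ)‖) (𝓝[>] 0) (𝓝 (Real.exp ((5 / 8) * (Lb'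 - Lb).re))))
    (hT : ∀ ε : ℝ, 0 < ε → ∃ K : ℝ, 0 < K ∧ ∀ (n : ℕ), 1 ≤ n → ∀ (Λ B : Finset HexVertex)
      (s t : Sym2 HexVertex), s ∈ hexDomainBoundary Λ → t ∈ hexDomainBoundary Λ → s ≠ t →
      dist (hexMidpoint s) (hexMidpoint t) ≤ n → (hexMidpoint t).im = (hexMidpoint s).im →
      (∀ v ∈ Λ, (hexMidpoint s).im < (hexCenter v).im) →
      (∀ v : HexVertex, v ∈ B ↔ ((hexMidpoint s).im < (hexCenter v).im ∧
        dist (hexCenter v) (hexMidpoint s) ≤ 2 * K * n)) →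
      (∑ γ : HexMidEdgeSAW Λ s t, if ∃ v ∈ γ.verts, K * n ≤ dist (hexCenter v) (hexMidpoint s)
        then hexCriticalFugacity ^ γ.length else 0) ≤
      ε * ∑ γ : HexMidEdgeSAW B s t, hexCriticalFugacity ^ γ.length)
    (hNR : ∀ (D : DobrushinDomain) (ρ : ℝ) (a b : ℝ → HexVertex),
      (0 < ρ ∧ (D.pt 1).im = (D.pt 0).im ∧ D.carrier ⊆ {z : ℂ | (D.pt 0).im < z.im} ∧
        D.carrier ∩ ball (D.pt 0) ρ = {z : ℂ | (D.pt 0).im < z.im} ∩ ball (D.pt 0) ρ ∧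
        D.carrier ∩ ball (D.pt 1) ρ = {z : ℂ | (D.pt 1).im < z.im} ∩ ball (D.pt 1) ρ) →
      IsEmbEndpointApprox hexGraph hexCenter D a b →
      (∀ᶠ δ : ℝ in 𝓝[>] 0,
        (a δ ∈ embMeshDomain hexGraph hexCenter D.carrier δ ∧
          ∃ w, hexGraph.Adj (a δ) w ∧ ¬ (hexDomainGraph D.carrier δ).Adj (a δ) w) ∧
        (b δ ∈ embMeshDomain hexGraph hexCenter D.carrier δ ∧
          ∃ w, hexGraph.Adj (b δ) w ∧ ¬ (hexDomainGraph D.carrier δ).Adj (b δ) w)) →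
      ∀ ℓ : ℝ, 0 < ℓ → ∀ η : ℝ, 0 < η → ∃ ε : ℝ, 0 < ε ∧ ∀ᶠ δ : ℝ in 𝓝[>] 0,
        hexSAWLaw D.carrier δ (a δ) (b δ)
            {γ | ∃ c : Curve ℂ, CurveClass.mk c = γ.curve ∧ ∃ s t : Fin 3 → unitInterval,
              (∀ i, s i ≤ t i) ∧ t 0 < s 1 ∧ t 1 < s 2 ∧
              (∀ i, ℓ ≤ Metric.diam ((⇑c) '' Set.Icc (s i) (t i))) ∧
              ∀ i j, Metric.hausdorffDist ((⇑c) '' Set.Icc (s i) (t i))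
                ((⇑c) '' Set.Icc (s j) (t j)) ≤ ε} ≤ ENNReal.ofReal η) :
    ∀ (D : DobrushinDomain) (ρ : ℝ) (a b : ℝ → HexVertex),
      (0 < ρ ∧ (D.pt 1).im = (D.pt 0).im ∧ D.carrier ⊆ {z : ℂ | (D.pt 0).im < z.im} ∧
        D.carrier ∩ ball (D.pt 0) ρ = {z : ℂ | (D.pt 0).im < z.im} ∩ ball (D.pt 0) ρ ∧
        D.carrier ∩ ball (D.pt 1) ρ = {z : ℂ | (D.pt 1).im < z.im} ∩ ball (D.pt 1) ρ) →
      IsEmbEndpointApprox hexGraph hexCenter D a b →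
      (∀ᶠ δ : ℝ in 𝓝[>] 0,
        (a δ ∈ embMeshDomain hexGraph hexCenter D.carrier δ ∧
          ∃ w, hexGraph.Adj (a δ) w ∧ ¬ (hexDomainGraph D.carrier δ).Adj (a δ) w) ∧
        (b δ ∈ embMeshDomain hexGraph hexCenter D.carrier δ ∧
          ∃ w, hexGraph.Adj (b δ) w ∧ ¬ (hexDomainGraph D.carrier δ).Adj (b δ) w)) →
      ConvergesInLawToSLE ((8 : ℝ≥0) / 3) D
        (fun δ (γ : HexDomainSAW D.carrier δ (a δ) (b δ)) => γ.curve)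
        (fun δ => hexSAWLaw D.carrier δ (a δ) (b δ)) :=
  hexConjectureFloor_of_cocycle_nonRetracing (hexAvoidanceCocycleFloor_of_floorRatioLimit hF hT) hNR

/-- **The floor class of DCS Conjecture 1 from three boundary/regularity estimates** — floor-ratio limit (boundary
conformal covariance, exponent 5/8), half-plane arch tightness, uniform injectivity modulus: convergence in law of the
critical hexagonal SAW to chordal SLE(8/3) on every floor domain with discrete-boundary endpoints.  No bulk observable,
no tightness input.  The last two hypotheses are verbatim crux-10472's registered stubs.
[cite: LawlerSchrammWerner2004SAW, §3.4 ("SAW satisfies restriction") and Prop. 2] -/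
theorem hexConjectureFloor_of_boundaryEstimates
    (hF : ∀ (D D' : DobrushinDomain) (ρ : ℝ) (Λ : ℝ → Finset HexVertex) (m₀ m m' : ℝ → ℤ) (a b b' : ℝ → Sym2 HexVertex) (Φ : ConformalEquiv D.carrier upperHalfPlaneSet) (L : ℂ → ℂ) (Lb Lb' : ℂ), D'.carrier = D.carrier → D'.pt 0 = D.pt 0 → 0 < ρ → D.carrier ∩ ball (D.pt 0) ρ = {z : ℂ | (D.pt 0).im < z.im} ∩ ball (D.pt 0) ρ → D.carrier ∩ ball (D.pt 1) ρ = {z : ℂ | (D.pt 1).im < z.im} ∩ ball (D.pt 1) ρ → D.carrier ∩ ball (D'.pt 1) ρ = {z : ℂ | (D'.pt 1).im < z.im} ∩ ball (D'.pt 1) ρ → (∀ᶠ δ : ℝ in 𝓝[>] 0, hexDomainSimplyConnected (Λ δ) ∧ a δ ∈ hexDomainBoundary (Λ δ) ∧ b δ ∈ hexDomainBoundary (Λ δ) ∧ b' δ ∈ hexDomainBoundary (Λ δ) ∧ Nonempty (HexMidEdgeSAW (Λ δ) (a δ) (b δ)) ∧ Nonempty (HexMidEdgeSAW (Λ δ)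 (a δ) (b' δ)) ∧ (hexGraph.induce (↑(Λ δ) : Set HexVertex)).Preconnected ∧ (∀ v ∈ Λ δ, (δ : ℂ) * hexCenter v ∈ D.carrier) ∧ (∀ v : HexVertex, (δ : ℂ) * hexCenter v ∈ ball (D.pt 0) ρ → (v ∈ Λ δ ↔ m₀ δ ≤ v.1 1)) ∧ (∀ v : HexVertex, (δ : ℂ) * hexCenter v ∈ ball (D.pt 1) ρ → (v ∈ Λ δ ↔ m δ ≤ v.1 1)) ∧ (∀ v : HexVertex, (δ : ℂ) * hexCenter v ∈ ball (D'.pt 1) ρ → (v ∈ Λ δ ↔ m' δ ≤ v.1 1))) → (∀ K : Set ℂ, IsCompact K → K ⊆ D.carrier → ∀ᶠ δ : ℝ in 𝓝[>] 0, ∀ v : HexVertex, (δ : ℂ) * hexCenter v ∈ K → v ∈ Λ δ) → Tendsto (fun δ : ℝ => (δ : ℂ) * hexMidpoint (a δ)) (𝓝[>] 0) (𝓝 (D.pt 0)) → Tendsto (fun δ : ℝ => (δ : ℂ) * hexMidpoint (b δ)) (𝓝[>] 0) (𝓝 (D.pt 1)) → Tendsto (fun δ : ℝ => (δ : ℂ)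 * hexMidpoint (b' δ)) (𝓝[>] 0) (𝓝 (D'.pt 1)) → Tendsto (fun x => ‖Φ x‖) (𝓝[D.carrier] (D.pt 0)) atTop → Φ.HasBoundaryValue (D.pt 1) 0 → ContinuousOn L D.carrier → (∀ z ∈ D.carrier, Complex.exp (L z) = deriv Φ z) → Tendsto L (𝓝[D.carrier] (D.pt 1)) (𝓝 Lb) → Tendsto L (𝓝[D.carrier] (D'.pt 1)) (𝓝 Lb') → Tendsto (fun δ : ℝ => ‖hexParafermionicObservable (Λ δ) (a δ) hexCriticalFugacity (5 / 8) (b' δ) / hexParafermionicObservable (Λ δ) (a δ) hexCriticalFugacity (5 / 8) (b δ)‖) (𝓝[>] 0) (𝓝 (Real.exp ((5 / 8) * (Lb' - Lb).re))))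
    (hT : ∀ ε : ℝ, 0 < ε → ∃ K : ℝ, 0 < K ∧ ∀ (n : ℕ), 1 ≤ n → ∀ (Λ B : Finset HexVertex)
      (s t : Sym2 HexVertex), s ∈ hexDomainBoundary Λ → t ∈ hexDomainBoundary Λ → s ≠ t →
      dist (hexMidpoint s) (hexMidpoint t) ≤ n → (hexMidpoint t).im = (hexMidpoint s).im →
      (∀ v ∈ Λ, (hexMidpoint s).im < (hexCenter v).im) →
      (∀ v : HexVertex, v ∈ B ↔ ((hexMidpoint s).im < (hexCenter v).im ∧
        dist (hexCenter v) (hexMidpoint s) ≤ 2 * K * n)) →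
      (∑ γ : HexMidEdgeSAW Λ s t, if ∃ v ∈ γ.verts, K * n ≤ dist (hexCenter v) (hexMidpoint s)
        then hexCriticalFugacity ^ γ.length else 0) ≤
      ε * ∑ γ : HexMidEdgeSAW B s t, hexCriticalFugacity ^ γ.length)
    (hU : ∀ (D : DobrushinDomain) (ρ : ℝ) (a b : ℝ → HexVertex),
      (0 < ρ ∧ (D.pt 1).im = (D.pt 0).im ∧ D.carrier ⊆ {z : ℂ | (D.pt 0).im < z.im} ∧
        D.carrier ∩ ball (D.pt 0) ρ = {z : ℂ | (D.pt 0).im < z.im} ∩ ball (D.pt 0) ρ ∧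
        D.carrier ∩ ball (D.pt 1) ρ = {z : ℂ | (D.pt 1).im < z.im} ∩ ball (D.pt 1) ρ) →
      (IsEmbEndpointApprox hexGraph hexCenter D a b ∧ ∀ᶠ δ : ℝ in 𝓝[>] 0,
      (∃ u : HexVertex, hexGraph.Adj (a δ) u ∧ ((δ : ℂ) * hexCenter u).im ≤ (D.pt 0).im) ∧
      (∃ u : HexVertex, hexGraph.Adj (b δ) u ∧ ((δ : ℂ) * hexCenter u).im ≤ (D.pt 1).im)) →
      ∀ ε η : ℝ, 0 < ε → 0 < η → ∃ θ : ℝ, 0 < θ ∧ ∀ᶠ δ : ℝ in 𝓝[>] 0,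
        hexSAWLaw D.carrier δ (a δ) (b δ) {γ | γ.curve ∉ CurveClass.modulusClass ε θ} ≤
          ENNReal.ofReal η) :
    ∀ (D : DobrushinDomain) (ρ : ℝ) (a b : ℝ → HexVertex),
      (0 < ρ ∧ (D.pt 1).im = (D.pt 0).im ∧ D.carrier ⊆ {z : ℂ | (D.pt 0).im < z.im} ∧
        D.carrier ∩ ball (D.pt 0) ρ = {z : ℂ | (D.pt 0).im < z.im} ∩ ball (D.pt 0) ρ ∧
        D.carrier ∩ ball (D.pt 1) ρ = {z : ℂ | (D.pt 1).im < z.im} ∩ ball (D.pt 1) ρ) →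
      IsEmbEndpointApprox hexGraph hexCenter D a b →
      (∀ᶠ δ : ℝ in 𝓝[>] 0,
        (a δ ∈ embMeshDomain hexGraph hexCenter D.carrier δ ∧
          ∃ w, hexGraph.Adj (a δ) w ∧ ¬ (hexDomainGraph D.carrier δ).Adj (a δ) w) ∧
        (b δ ∈ embMeshDomain hexGraph hexCenter D.carrier δ ∧
          ∃ w, hexGraph.Adj (b δ) w ∧ ¬ (hexDomainGraph D.carrier δ).Adj (b δ) w)) →
      ConvergesInLawToSLE ((8 : ℝ≥0) / 3) D
        (fun δ (γ : HexDomainSAW D.carrier δ (a δ) (b δ)) => γ.curve)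
        (fun δ => hexSAWLaw D.carrier δ (a δ) (b δ)) :=
  hexConjectureFloor_of_floorRatioLimit hF hT (nonRetracingFloor_of_uniformModulus hU)

end Summit.CriticalPhenomena.SAWScalingLimit.Theorems.HexConjecture.RootLocality

end
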